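import Summits.Langlands.Statement
import HarnessLib

/-!
# Birth skeleton (BC3) for the child `SatakeAvatarCompatibility` (LGC∀) of the split of
`FifteenLocusEisenstein.SectorComplement` (stmt-Langlands-16058) — line `birth16058_SatakeAvatarCompatibility`

LGC∀ = Taylor 2004 Conj. 7 for Satake pairs and EVERY reciprocity datum, cut along the three clauses of the conjecture:

* `stub_avatarDeRham` (D) — an irreducible Satake avatar of an L-algebraic cuspidal `π` is de Rham above `ℓ` for Fontaine's
  pinned datum (Taylor Conj. 7 (a), Fontaine–Mazur; known in the Shimura-variety / eigenvariety regular range, A'Campo 2024,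
  Caraiani–Newton 2023; open for irregular `π`);
* `stub_compatibilityAway` (L∤) — local–global compatibility at `v ∤ ℓ`, Grothendieck–Deligne WD representation
  `ι WD(ρ|_v)^{F-ss} ≅ rec_v(π_v)`, for every Henniart-normalised `𝓡` (known up to semisimplification for regular `π`
  over CM fields: Harris–Taylor, Taylor–Yoshida, Caraiani 2012, Varma 2024; the monodromy operator and irregular `π` open);
* `stub_compatibilityAbove` (L∣) — local–global compatibility at `v ∣ ℓ` through Fontaine's `D_pst` for de Rham avatars
  (Fontaine's `C_WD` for the automorphic compatible system; Caraiani 2014, BLGGT `ℓ = p`, A'Campo; the tree's PINNED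
  `WD ∘ D_pst` is decidable on the unramified sector since D1/(F9), the ramified sector waits for the definition item D2).

Composition `SatakeAvatarCompatibility_of : D → L∤ → L∣ → LGC∀` (case split `v ∣ ℓ`).  Conclusion stated as the TEXT of
LGC∀ (= the child decl by `Iff.rfl` once the split is rendered).  Imports `Summits.Langlands.Statement` only.
Sorries: exactly the three stubs.
-/

noncomputable section

set_option linter.dupNamespace false

open scoped NumberField Classical Polynomial
open Filter IsDedekindDomain Polynomial
open Literature.NumberTheory.Automorphic Literature.NumberTheory.GaloisRepresentations
open Summit.Langlands

namespace Summit.Langlands.Langlands.Cruxes.SectorComplement.Birth16058SatakeAvatarCompatibility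

/-- **stub D — Satake avatars are de Rham above `ℓ`.** [cite: TaylorGaloisRepresentations2004, Conj. 7]
[cite: FontaineMazurGeometric1995, Conj. 1] -/
theorem stub_avatarDeRham : ∀ (K : Type) [Field K] [NumberField K] (n : ℕ) (hcpt : Literature.NumberTheory.Automorphic.isCompact_glFiniteIntegralLevel n K), 0 < n → ∀ (π : Literature.NumberTheory.Automorphic.CuspidalAutomorphicRepData n K hcpt), π.1.IsLAlgebraic → ∀ (ℓ : ℕ) [Fact ℓ.Prime] (ι : PadicAlgCl ℓ ≃+* ℂ) (ρ : Literature.NumberTheory.GaloisRepresentations.FramedGaloisRep K (PadicAlgCl ℓ) n), ρ.toGaloisRep.IsIrreducible → (∀ᶠ v : IsDedekindDomain.HeightOneSpectrum (NumberField.RingOfIntegers K) in Filter.cofinite, SatakeFrobCompatibleAt ι π.1 ρ v) → (∀ (v : IsDedekindDomain.HeightOneSpectrum (NumberField.RingOfIntegers K)) (hv : ((ℓ : ℕ) : NumberField.RingOfIntegers K) ∈ v.asIdeal), (Literature.NumberTheory.PAdicHodge.fontainePstAdicCompletion v ℓ hv).IsDeRhamFramed (ρ.toLocal v)) := by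
  sorry

/-- **stub L∤ — local–global compatibility away from `ℓ`, every `𝓡`.** [cite: TaylorGaloisRepresentations2004, Conj. 7]
[cite: HarrisTaylorAMS2001, Thm. A] -/
theorem stub_compatibilityAway : ∀ (K : Type) [Field K] [NumberField K] (n : ℕ) (hcpt : Literature.NumberTheory.Automorphic.isCompact_glFiniteIntegralLevel n K), 0 < n → ∀ (π : Literature.NumberTheory.Automorphic.CuspidalAutomorphicRepData n K hcpt), π.1.IsLAlgebraic → ∀ (ℓ : ℕ) [Fact ℓ.Prime] (ι : PadicAlgCl ℓ ≃+* ℂ) (ρ : Literature.NumberTheory.GaloisRepresentations.FramedGaloisRep K (PadicAlgCl ℓ) n), ρ.toGaloisRep.IsIrreducible → (∀ᶠ v : IsDedekindDomain.HeightOneSpectrum (NumberField.RingOfIntegers K) in Filter.cofinite, SatakeFrobCompatibleAt ι π.1 ρ v) → ∀ (𝓡 : ReciprocityData K) (v : IsDedekindDomain.HeightOneSpectrum (NumberField.RingOfIntegers K)), ((ℓ : ℕ) : NumberField.RingOfIntegers K) ∉ v.asIdeal → LocalGlobalCompatibleAt 𝓡 ι π.1 ρ v := by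
  sorry

/-- **stub L∣ — local–global compatibility above `ℓ` for de Rham avatars, every `𝓡`.**
[cite: TaylorGaloisRepresentations2004, Conj. 7] [cite: FontaineAsterisque223VIII, §2.3.7] -/
theorem stub_compatibilityAbove : ∀ (K : Type) [Field K] [NumberField K] (n : ℕ) (hcpt : Literature.NumberTheory.Automorphic.isCompact_glFiniteIntegralLevel n K), 0 < n → ∀ (π : Literature.NumberTheory.Automorphic.CuspidalAutomorphicRepData n K hcpt), π.1.IsLAlgebraic → ∀ (ℓ : ℕ) [Fact ℓ.Prime] (ι : PadicAlgCl ℓ ≃+* ℂ) (ρ : Literature.NumberTheory.GaloisRepresentations.FramedGaloisRep K (PadicAlgCl ℓ) n), ρ.toGaloisRep.IsIrreducible → (∀ᶠ v : IsDedekindDomain.HeightOneSpectrum (NumberField.RingOfIntegers K) in Filter.cofinite, SatakeFrobCompatibleAt ι π.1 ρ v) → (∀ (v : IsDedekindDomain.HeightOneSpectrum (NumberField.RingOfIntegers K)) (hv : ((ℓ : ℕ) : NumberField.RingOfIntegers K) ∈ v.asIdeal), (Literature.NumberTheory.PAdicHodge.fontainePstAdicCompletion v ℓ hv).IsDeRhamFramed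 (ρ.toLocal v)) → ∀ (𝓡 : ReciprocityData K) (v : IsDedekindDomain.HeightOneSpectrum (NumberField.RingOfIntegers K)), ((ℓ : ℕ) : NumberField.RingOfIntegers K) ∈ v.asIdeal → LocalGlobalCompatibleAt 𝓡 ι π.1 ρ v := by
  sorry

/-- **LGC∀ from D, L∤, L∣.** [folklore] -/
theorem SatakeAvatarCompatibility_of :
    (∀ (K : Type) [Field K] [NumberField K] (n : ℕ) (hcpt : Literature.NumberTheory.Automorphic.isCompact_glFiniteIntegralLevel n K), 0 < n → ∀ (π : Literature.NumberTheory.Automorphic.CuspidalAutomorphicRepData n K hcpt), π.1.IsLAlgebraic → ∀ (ℓ : ℕ) [Fact ℓ.Prime] (ι : PadicAlgCl ℓ ≃+* ℂ) (ρ : Literature.NumberTheory.GaloisRepresentations.FramedGaloisRep K (PadicAlgCl ℓ) n), ρ.toGaloisRep.IsIrreducible → (∀ᶠ v : IsDedekindDomain.HeightOneSpectrum (NumberField.RingOfIntegers K) in Filter.cofinite, SatakeFrobCompatibleAt ι π.1 ρ v) → (∀ (v : IsDedekindDomain.HeightOneSpectrum (NumberField.RingOfIntegers K)) (hv : ((ℓ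 : ℕ) : NumberField.RingOfIntegers K) ∈ v.asIdeal), (Literature.NumberTheory.PAdicHodge.fontainePstAdicCompletion v ℓ hv).IsDeRhamFramed (ρ.toLocal v))) →
    (∀ (K : Type) [Field K] [NumberField K] (n : ℕ) (hcpt : Literature.NumberTheory.Automorphic.isCompact_glFiniteIntegralLevel n K), 0 < n → ∀ (π : Literature.NumberTheory.Automorphic.CuspidalAutomorphicRepData n K hcpt), π.1.IsLAlgebraic → ∀ (ℓ : ℕ) [Fact ℓ.Prime] (ι : PadicAlgCl ℓ ≃+* ℂ) (ρ : Literature.NumberTheory.GaloisRepresentations.FramedGaloisRep K (PadicAlgCl ℓ) n), ρ.toGaloisRep.IsIrreducible → (∀ᶠ v : IsDedekindDomain.HeightOneSpectrum (NumberField.RingOfIntegers K) in Filter.cofinite, SatakeFrobCompatibleAt ι π.1 ρ v) → ∀ (𝓡 : ReciprocityData K) (v : IsDedekindDomain.HeightOneSpectrum (NumberField.RingOfIntegers K)), ((ℓ : ℕ) : NumberField.RingOfIntegers K) ∉ v.asIdeal → LocalGlobalCompatibleAt 𝓡 ι π.1 ρ v) →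
    (∀ (K : Type) [Field K] [NumberField K] (n : ℕ) (hcpt : Literature.NumberTheory.Automorphic.isCompact_glFiniteIntegralLevel n K), 0 < n → ∀ (π : Literature.NumberTheory.Automorphic.CuspidalAutomorphicRepData n K hcpt), π.1.IsLAlgebraic → ∀ (ℓ : ℕ) [Fact ℓ.Prime] (ι : PadicAlgCl ℓ ≃+* ℂ) (ρ : Literature.NumberTheory.GaloisRepresentations.FramedGaloisRep K (PadicAlgCl ℓ) n), ρ.toGaloisRep.IsIrreducible → (∀ᶠ v : IsDedekindDomain.HeightOneSpectrum (NumberField.RingOfIntegers K) in Filter.cofinite, SatakeFrobCompatibleAt ι π.1 ρ v) → (∀ (v : IsDedekindDomain.HeightOneSpectrum (NumberField.RingOfIntegers K)) (hv : ((ℓ : ℕ) : NumberField.RingOfIntegers K) ∈ v.asIdeal), (Literature.NumberTheory.PAdicHodge.fontainePstAdicCompletion v ℓ hv).IsDeRhamFramed (ρ.toLocal v)) → ∀ (𝓡 : ReciprocityData K) (v : IsDedekindDomain.HeightOneSpectrum (NumberField.RingOfIntegers K)), ((ℓ : ℕ) : NumberField.RingOfIntegers K) ∈ v.asIdeal → LocalGlobalCompatibleAt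 𝓡 ι π.1 ρ v) →
    (∀ (K : Type) [Field K] [NumberField K] (n : ℕ) (hcpt : Literature.NumberTheory.Automorphic.isCompact_glFiniteIntegralLevel n K), 0 < n → ∀ (π : Literature.NumberTheory.Automorphic.CuspidalAutomorphicRepData n K hcpt), π.1.IsLAlgebraic → ∀ (ℓ : ℕ) [Fact ℓ.Prime] (ι : PadicAlgCl ℓ ≃+* ℂ) (ρ : Literature.NumberTheory.GaloisRepresentations.FramedGaloisRep K (PadicAlgCl ℓ) n), ρ.toGaloisRep.IsIrreducible → (∀ᶠ v : IsDedekindDomain.HeightOneSpectrum (NumberField.RingOfIntegers K) in Filter.cofinite, SatakeFrobCompatibleAt ι π.1 ρ v) → (∀ (v : IsDedekindDomain.HeightOneSpectrum (NumberField.RingOfIntegers K)) (hv : ((ℓ : ℕ) : NumberField.RingOfIntegers K) ∈ v.asIdeal), (Literature.NumberTheory.PAdicHodge.fontainePstAdicCompletion v ℓ hv).IsDeRhamFramed (ρ.toLocal v)) ∧ ∀ (𝓡 : ReciprocityData K) (v : IsDedekindDomain.HeightOneSpectrum (NumberField.RingOfIntegers K)), LocalGlobalCompatibleAt 𝓡 ι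 π.1 ρ v) := by
  intro hD hA hP K _ _ n hcpt hn π hπ ℓ _ ι ρ hirr hρ
  have hdR := hD K n hcpt hn π hπ ℓ ι ρ hirr hρ
  refine ⟨hdR, fun 𝓡 v => ?_⟩
  by_cases hv : ((ℓ : ℕ) : NumberField.RingOfIntegers K) ∈ v.asIdeal
  · exact hP K n hcpt hn π hπ ℓ ι ρ hirr hρ hdR 𝓡 v hv
  · exact hA K n hcpt hn π hπ ℓ ι ρ hirr hρ 𝓡 v hv

/-- LGC∀ (text) from the stubs. -/
theorem SatakeAvatarCompatibility_of_stubs : ∀ (K : Type) [Field K] [NumberField K] (n : ℕ) (hcpt : Literature.NumberTheory.Automorphic.isCompact_glFiniteIntegralLevel n K), 0 < n → ∀ (π : Literature.NumberTheory.Automorphic.CuspidalAutomorphicRepData n K hcpt), π.1.IsLAlgebraic → ∀ (ℓ : ℕ) [Fact ℓ.Prime] (ι : PadicAlgCl ℓ ≃+* ℂ) (ρ : Literature.NumberTheory.GaloisRepresentations.FramedGaloisRep K (PadicAlgCl ℓ) n), ρ.toGaloisRep.IsIrreducible → (∀ᶠ v : IsDedekindDomain.HeightOneSpectrum (NumberField.RingOfIntegers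 K) in Filter.cofinite, SatakeFrobCompatibleAt ι π.1 ρ v) → (∀ (v : IsDedekindDomain.HeightOneSpectrum (NumberField.RingOfIntegers K)) (hv : ((ℓ : ℕ) : NumberField.RingOfIntegers K) ∈ v.asIdeal), (Literature.NumberTheory.PAdicHodge.fontainePstAdicCompletion v ℓ hv).IsDeRhamFramed (ρ.toLocal v)) ∧ ∀ (𝓡 : ReciprocityData K) (v : IsDedekindDomain.HeightOneSpectrum (NumberField.RingOfIntegers K)), LocalGlobalCompatibleAt 𝓡 ι π.1 ρ v :=
  SatakeAvatarCompatibility_of stub_avatarDeRham stub_compatibilityAway stub_compatibilityAbove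

end Summit.Langlands.Langlands.Cruxes.SectorComplement.Birth16058SatakeAvatarCompatibility

end
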